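import Summits.Ventures.GridStability.Lyapunov.RelativeLffNonUniformRoa
import HarnessLib

/-!
# GridStability/Lyapunov/RelativeLffNonUniformRegion — generic NON-UNIFORM-damping LFF closed form,
# part 5: EVERY lossless classical multimachine model with positive per-machine damping has a
# certified synchronisation region (solver-free, every `n`)

Venture GRIDFUSION, LFF lane, lead RULING R-LFF-NU-ROW (2026-08-27T06:44:49Z «generic statement
pending»); seat gridfusion-lyap-1 (g5); namespace `Summit.Ventures.GridStability.Lyapunov.RelativeLffNU`.
Parts 1–4: `RelativeLffNonUniform{,RefT,Cert,Roa}.lean`. HERE the last two generic ingredients and the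
headline:

* `rankOne_of_margin` — for ANY certificate `Λ` of ANY system of the family, the rank-one facts of the
  third construction come for free from the coercivity margin: `s_k·Q − C_kᵀC_k ⪰ 0` with
  `s_k = (|C_k|² + 1)/ε` (Cauchy–Schwarz);
* `vtGap_pos` — Vu–Turitsyn's gap `2cos δ − (π − 2|δ|)·sin|δ| > 0` for `|δ| < π/2` (`x < tan x`);
* `exists_synchronisation_region` — **for every typed lossless model `d : RecastData n` (machines
  `0..n`) with positive inertias, positive dampings `D_i` whose ratios `D_i/M_i` are NOT all equal,
  positive couplings, `G_ij = 0` and `B_ij = B_ji > 0` off the diagonal, A1 equilibrium data `θ*` with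
  `|θ*_p − θ*_q| < π/2` on every line: THERE IS a member `Λ` of Vu–Turitsyn's family on Pai's
  machine-reference space and a level `c₀ > V(0)` such that from EVERY machine state whose
  machine-reference state lies in `{𝒫, V ≤ c₀}` the classical model has exactly one solution on `ℝ`, it
  keeps `{𝒫, V ≤ c₀}` for all `t ≥ 0`, all `n + 1` speed deviations `→ 0` and every relative rotor angle
  `→` its equilibrium value** — regional synchronisation of the lossless multimachine model with
  arbitrary positive damping, by a Lyapunov function of Lur'e–Postnikov type in closed form, with no
  semidefinite programme and no uniform-damping hypothesis (the scalars `c′ = 1`,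
  `τ = (ΣM²/D)/ΣD + 1`, `h = 1/(ΣM/D + τ)` pass the test of part 3). Instances sharpen `c₀` by `decide`.

THREE COLUMNS. CERTIFIED (kernel): the theorem above about the MODEL CLASS = lossless network-reduced
classical multimachine model (`RecastData.toModel`, MV-2L; per-machine damping, NO MV-λ); inner
estimate; CLASS = Vu–Turitsyn certificates. VALIDATED: nothing. No sentence of this file says that any
grid is stable. No definitions, no named fact; standard axioms.
-/

noncomputable section

open Real Set Filter Matrix Finset
open scoped Topology
open Literature.MathematicalPhysics.PowerSystems
open Literature.MathematicalPhysics.PowerSystems.LyapunovFunctionFamily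
open Literature.MathematicalPhysics.PowerSystems.ClassicalModel.LosslessSystem (vtGap)
open InternalNode (refT)
open Summit.Ventures.GridStability.Models

namespace Summit.Ventures.GridStability.Lyapunov.RelativeLffNU

/-! ### §13 Rank-one facts from the coercivity margin; the gap is positive -/

/-- A real matrix with `Pᵀ = P` and a non-negative quadratic form is positive semidefinite
(plumbing). -/
private theorem posSemidef_of_transpose_of_nonneg₃ {m : Type*} [Fintype m] {P : Matrix m m ℝ}
    (hsymm : Pᵀ = P) (h : ∀ x : m → ℝ, 0 ≤ x ⬝ᵥ (P *ᵥ x)) : P.PosSemidef := by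
  refine Matrix.PosSemidef.of_dotProduct_mulVec_nonneg ?_ fun x => ?_
  · rw [Matrix.IsHermitian, Matrix.conjTranspose_eq_transpose_of_trivial]
    exact hsymm
  · rw [star_trivial]
    exact h x

/-- `(abᵀ)·v = (b·v)·a` (plumbing). -/
private theorem vecMulVec_mulVec₃ {m k : Type*} [Fintype k] (a : m → ℝ) (b : k → ℝ)
    (v : k → ℝ) : Matrix.vecMulVec a b *ᵥ v = (b ⬝ᵥ v) • a := by
  funext i
  simp only [Matrix.mulVec, dotProduct, Matrix.vecMulVec_apply, Pi.smul_apply, smul_eq_mul]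
  rw [mul_comm, Finset.mul_sum]
  exact Finset.sum_congr rfl fun j _ => by ring

/-- **Rank-one facts for free**: for every certificate `Λ` of the family and every channel `k`,
`s_k·Q − C_kᵀC_k ⪰ 0` with `s_k = (|C_k|² + 1)/ε` (`Q ⪰ ε1` and Cauchy–Schwarz `(C_k·x)² ≤ |C_k|²|x|²`).
[cite: VuTuritsyn2016, Appendix 9.3] -/
theorem rankOne_of_margin {ι κ : Type*} [Fintype ι] [Fintype κ] [DecidableEq ι] [DecidableEq κ]
    {S : System ι κ} (Λ : Certificate S) (k : κ) :
    (((S.C k ⬝ᵥ S.C k + 1) / Λ.ε) • Λ.Q - Matrix.vecMulVec (S.C k) (S.C k)).PosSemidef := by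
  have hε := Λ.ε_pos
  have hcc : 0 ≤ S.C k ⬝ᵥ S.C k := Finset.sum_nonneg fun i _ => mul_self_nonneg _
  have hs : 0 ≤ (S.C k ⬝ᵥ S.C k + 1) / Λ.ε := div_nonneg (by linarith) hε.le
  refine posSemidef_of_transpose_of_nonneg₃ ?_ fun x => ?_
  · rw [Matrix.transpose_sub, Matrix.transpose_smul, Λ.Q_symm]
    congr 1
    ext i j
    simp [Matrix.vecMulVec_apply, mul_comm]
  · have hQ : Λ.ε * (x ⬝ᵥ x) ≤ x ⬝ᵥ (Λ.Q *ᵥ x) := by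
      have h := Λ.Q_ge.dotProduct_mulVec_nonneg x
      rw [star_trivial, Matrix.sub_mulVec, dotProduct_sub, Matrix.smul_mulVec, Matrix.one_mulVec,
        dotProduct_smul, smul_eq_mul] at h
      linarith
    have hcs : (S.C k ⬝ᵥ x) ^ 2 ≤ (S.C k ⬝ᵥ S.C k) * (x ⬝ᵥ x) := by
      have h := Finset.sum_mul_sq_le_sq_mul_sq Finset.univ (S.C k) x
      simpa only [dotProduct, pow_two] using h
    have hxx : 0 ≤ x ⬝ᵥ x := Finset.sum_nonneg fun i _ => mul_self_nonneg _
    rw [Matrix.sub_mulVec, dotProduct_sub, Matrix.smul_mulVec, dotProduct_smul, smul_eq_mul,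
      vecMulVec_mulVec₃, dotProduct_smul, smul_eq_mul, dotProduct_comm x (S.C k)]
    have h1 : (S.C k ⬝ᵥ S.C k + 1) / Λ.ε * (Λ.ε * (x ⬝ᵥ x)) ≤ (S.C k ⬝ᵥ S.C k + 1) / Λ.ε * (x ⬝ᵥ (Λ.Q *ᵥ x)) :=
      mul_le_mul_of_nonneg_left hQ hs
    have h2 : (S.C k ⬝ᵥ S.C k + 1) / Λ.ε * (Λ.ε * (x ⬝ᵥ x)) = (S.C k ⬝ᵥ S.C k + 1) * (x ⬝ᵥ x) := by
      field_simp
    nlinarith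

/-- **Vu–Turitsyn's gap is positive inside the principal window**: `2cos δ − (π − 2|δ|)·sin|δ| > 0`
for `|δ| < π/2` (`x < tan x` at `x = π/2 − |δ|`). [cite: VuTuritsyn2016, Appendix 9.3] -/
theorem vtGap_pos {δ : ℝ} (hδ : |δ| < π / 2) : 0 < vtGap δ := by
  unfold vtGap
  rw [← Real.cos_abs δ]
  have ha0 : 0 ≤ |δ| := abs_nonneg δ
  rcases eq_or_lt_of_le ha0 with h0 | hpos
  · rw [← h0]; simp
  · have hx1 : 0 < π / 2 - |δ| := by linarith
    have hx2 : π / 2 - |δ| < π / 2 := by linarith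
    have htan := Real.lt_tan hx1 hx2
    rw [Real.tan_eq_sin_div_cos, Real.sin_pi_div_two_sub, Real.cos_pi_div_two_sub] at htan
    have hsin : 0 < Real.sin |δ| := Real.sin_pos_of_pos_of_lt_pi hpos (by linarith [Real.pi_pos])
    rw [lt_div_iff₀ hsin] at htan
    nlinarith

/-! ### §14 THE HEADLINE: a certified synchronisation region for every lossless model -/

variable {n : ℕ} (d : RecastData n)

/-- **EVERY LOSSLESS CLASSICAL MULTIMACHINE MODEL WITH POSITIVE (NON-UNIFORM) DAMPING HAS A CERTIFIED
SYNCHRONISATION REGION — solver-free, every `n`.** For a typed lossless recast model `d` (machines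
`0..n`; `M_i, D_i > 0` with the ratios `D_i/M_i` not all equal; couplings `C_ij > 0`, `G_ij = 0`,
`B_ij = B_ji > 0` off the diagonal; A1 equilibrium data `θ*` with `|θ*_p − θ*_q| < π/2` on every line)
there are a member `Λ` of Vu–Turitsyn's Lyapunov-functions family on Pai's machine-reference space
(the closed form of parts 1–3 with `c′ = 1`, `τ = (ΣM²/D)/ΣD + 1`, `h = 1/(ΣM/D + τ)`) and a level
`c₀ > V(0)` such that: from every machine state `x₀` whose machine-reference state
`((ω_i)_i | ((δ_{a+1} − δ_0) − (θ*_{a+1} − θ*_0))_a)` lies in the polytope `𝒫` with `V ≤ c₀`, the model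
has EXACTLY ONE solution on `ℝ`; it keeps `{𝒫, V ≤ c₀}` for all `t ≥ 0`; all `n + 1` speed deviations
tend to `0` and every relative rotor angle tends to its equilibrium value. MODELLED: lossless
network-reduced classical model, per-machine damping (MV-2L; NO uniform-λ hypothesis); inner estimate;
no sentence here says that any grid is stable.
[cite: VuTuritsyn2016, §III eq. (QKH), §IV set ℛ; Pai1981, §3.6.3 eq. (3.45); Teschl2012, Thm. 2.2] -/
theorem exists_synchronisation_region (hB : ∀ i j, i ≠ j → 0 < d.B i j)
    (hG : ∀ i j, i ≠ j → d.G i j = 0) (hBs : ∀ i j, d.B i j = d.B j i) {δs : Fin (n + 1) → ℝ}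
    (hE : d.EqData δs) (hM : ∀ i, 0 < d.M i) (hD : ∀ i, 0 < d.D i)
    (hC : ∀ i j : Fin (n + 1), i ≠ j → 0 < d.Cc i j)
    (hlam : ∃ i j : Fin (n + 1), d.D i / d.M i ≠ d.D j / d.M j)
    (hδs : ∀ k : RecastData.LffPair n, |RecastData.lffδso δs k| < π / 2) :
    ∃ Λ : Certificate (nuSystem d δs), ∃ c₀ : ℝ, Λ.V 0 < c₀ ∧
      ∀ x₀ : ClassicalSwing.State (n + 1), d.lurieState δs x₀ ∈ (nuSystem d δs).polytope →
        Λ.V (d.lurieState δs x₀) ≤ c₀ →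
        (∃! c : ℝ → ClassicalSwing.State (n + 1), c 0 = x₀ ∧ d.toModel.IsSolutionOn c univ) ∧
          ∀ c : ℝ → ClassicalSwing.State (n + 1), c 0 = x₀ → d.toModel.IsSolutionOn c univ →
            (∀ t, 0 ≤ t → d.lurieState δs (c t) ∈ (nuSystem d δs).polytope ∧
                Λ.V (d.lurieState δs (c t)) ≤ c₀) ∧
              Tendsto (fun t => d.lurieState δs (c t)) atTop (𝓝 0) := by
  -- the scalars
  have hMv : ∀ i, 0 < Mv d i := fun i => by unfold Mv; exact_mod_cast hM i
  have hDv : ∀ i, 0 < Dv d i := fun i => by unfold Dv; exact_mod_cast hD i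
  have hS : 0 < Dsum (Dv d) := Finset.sum_pos (fun i _ => hDv i) Finset.univ_nonempty
  set ρ : ℝ := (∑ i, Mv d i ^ 2 / Dv d i) / Dsum (Dv d) with hρ
  have hρ0 : 0 ≤ ρ := div_nonneg (Finset.sum_nonneg fun i _ => div_nonneg (sq_nonneg _) (hDv i).le) hS.le
  set τ : ℝ := ρ + 1 with hτ
  have hτ1 : 1 ≤ τ := by linarith
  have hτpos : 0 < τ := by linarith
  set R : ℝ := ∑ i, Mv d i / Dv d i with hR
  have hRi : ∀ i, Mv d i / Dv d i ≤ R := fun i =>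
    Finset.single_le_sum (fun j _ => div_nonneg (hMv j).le (hDv j).le) (Finset.mem_univ i)
  have hR0 : 0 ≤ R := Finset.sum_nonneg fun j _ => div_nonneg (hMv j).le (hDv j).le
  set h : ℝ := 1 / (R + τ) with hh
  have hRτ : 0 < R + τ := by linarith
  have hhpos : 0 < h := by rw [hh]; positivity
  have hτ2 : ∑ i, Mv d i ^ 2 / Dv d i ≤ τ ^ 2 * Dsum (Dv d) := by
    have e : ∑ i, Mv d i ^ 2 / Dv d i = ρ * Dsum (Dv d) := by rw [hρ]; field_simp
    rw [e]
    have : ρ ≤ τ ^ 2 := by nlinarith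
    exact mul_le_mul_of_nonneg_right this hS.le
  have hcond : ∀ i, h * (Mv d i / Dv d i + τ) ≤ 1 := by
    intro i
    rw [hh, one_div_mul_eq_div, div_le_one hRτ]
    linarith [hRi i]
  obtain ⟨Λ, -, -, -⟩ := exists_certificate d δs 1 h hM hD hC one_pos hhpos hτpos hτ2 hcond
  -- rank-one facts and the gap
  set s : RecastData.LffPair n → ℝ :=
    fun k => ((nuSystem d δs).C k ⬝ᵥ (nuSystem d δs).C k + 1) / Λ.ε with hs
  have hs0 : ∀ k, 0 < s k := fun k =>
    div_pos (by linarith [show 0 ≤ (nuSystem d δs).C k ⬝ᵥ (nuSystem d δs).C k from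
      Finset.sum_nonneg fun i _ => mul_self_nonneg _]) Λ.ε_pos
  have hsf : ∀ k, (s k • Λ.Q - Matrix.vecMulVec ((nuSystem d δs).C k) ((nuSystem d δs).C k)).PosSemidef :=
    fun k => rankOne_of_margin Λ k
  set gap : RecastData.LffPair n → ℝ := fun k =>
    (π - 2 * |RecastData.lffδso δs k|) ^ 2 / (2 * s k) + Λ.kK k * vtGap (RecastData.lffδso δs k) with hgap
  have hgap_pos : ∀ k, 0 < gap k := by
    intro k
    have h1 : 0 < (π - 2 * |RecastData.lffδso δs k|) ^ 2 / (2 * s k) := by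
      have : 0 < π - 2 * |RecastData.lffδso δs k| := by linarith [hδs k]
      exact div_pos (by positivity) (by linarith [hs0 k])
    have h2 : 0 ≤ Λ.kK k * vtGap (RecastData.lffδso δs k) :=
      mul_nonneg (Λ.kK_nonneg k) (vtGap_pos (hδs k)).le
    simp only [hgap]; linarith
  -- the level: half the smallest gap above `V(0)` (or anything, if there is no line)
  have hlev : ∃ c₀ : ℝ, Λ.V 0 < c₀ ∧ ∀ k, c₀ < Λ.V 0 + gap k := by
    by_cases hne : (Finset.univ : Finset (RecastData.LffPair n)).Nonempty
    · obtain ⟨k₀, -, hk₀⟩ := Finset.exists_min_image Finset.univ gap hne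
      refine ⟨Λ.V 0 + gap k₀ / 2, by linarith [hgap_pos k₀], fun k => ?_⟩
      have := hk₀ k (Finset.mem_univ k)
      linarith [hgap_pos k₀]
    · refine ⟨Λ.V 0 + 1, by linarith, fun k => ?_⟩
      exact absurd ⟨k, Finset.mem_univ k⟩ hne
  obtain ⟨c₀, hc₀V, hc₀⟩ := hlev
  refine ⟨Λ, c₀, hc₀V, fun x₀ hy hyc => ?_⟩
  exact synchronisation_of_state d hB hG hBs hE Λ (hlam_of_rat d hlam) hδs hs0 hsf
    (fun k => by have := hc₀ k; simp only [hgap] at this; linarith) x₀ hy hyc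

end Summit.Ventures.GridStability.Lyapunov.RelativeLffNU

end
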